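import Summits.NavierStokesRegularity.NavierStokesRegularity.Theorems.PoloidalWindowDoorPoloidalWindowRigidityZShockNoLocalizedBreatherTrivial
import Summits.NavierStokesRegularity.NavierStokesRegularity.Theorems.PoloidalWindowDoorPoloidalWindowRigidityZShockNoetherConeEnergyClass
import HarnessLib

/-!
# Crux K2 `PoloidalWindowRigidity` (stmt-NavierStokesRegularity-19708), line `z_shock` — breather door, sharp form: finite Noether energy at ONE
# height propagates to all heights (domain of dependence, zero source), so a height-periodic pattern with finite horizontal energy at a single
# height is trivial

`--supports stmt-NavierStokesRegularity-19708 --as helper` (leafhand-ns-poloidalwindowdoor-3 g11, cell decomp-ns, 2026-08-31).  Def-free; sequel of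
`…ZShockNoLocalizedBreatherTrivial` (p834402) using the cone energy of `…ZShockLocalEnergy` (p826600, source `0`, no exponential factor) and the
coercivity / flux domination of the centred Noether energy (`…ZShockNoetherEnergyCoercive`).  **No stub and no summit is closed by this file;
Navier–Stokes regularity is NOT proved here (rung 0).**

* `energyLaw_pointwise` — the Noether energy law of the autonomous height-evolution in the `(s, y)` format:
  `∂ₛ[Ψ(w⋆) − Ψ(w) + ½|u|²] + Σᵢ ∂ᵢ[−Γ(w) uᵢ] = 0` (`Γ' = G`, `Ψ' = Γ`; poloidality is not needed);
* `noether_ball_le` — on a uniformly hyperbolic column (`−γhi ≤ G ≤ −γlo < 0`, `Γ(w⋆) = 0`) the centred energy `E = Ψ(w⋆) − Ψ(w) + ½|u|² ≥ 0`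
  obeys `∫_{|y| ≤ ρ} E(t) ≤ ∫_{|y| ≤ √(1+ρ²) + (γhi/√γlo)(t − t₀) + 1} E(t₀)` for `t ≥ t₀` (speed `γhi/√γlo`, no growth factor);
* `integrable_of_ball_bounds` — a continuous non-negative function with uniformly bounded integrals over balls is integrable (monotone convergence);
* ★ `no_breather_of_finite_energy_at_one_height` — a jointly smooth, `P`-periodic-in-height solution of the autonomous height-evolution on a uniformly
  hyperbolic column whose horizontal energy `∫(|u|² + (w − w⋆)²)(t₀, y) dy` is finite at ONE height `t₀` is trivial: `w ≡ w⋆`, `u ≡ 0`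
  (energy at `t₀` ⇒ uniform ball bounds at all later heights ⇒ by periodicity at all heights ⇒ `no_localized_breather_trivial`).
[folklore]
-/

noncomputable section

namespace Summit.NavierStokesRegularity.NavierStokesRegularity.Theorems.PoloidalWindowDoorPoloidalWindowRigidityZShockBreatherOneHeight

-- the summit and its single sub-problem share the name (CONVENTIONS §1)
set_option linter.dupNamespace false

open Set Filter Topology Function MeasureTheory Metric
open scoped ContDiff ENNReal
open Summit.NavierStokesRegularity.NavierStokesRegularity.Theorems.PoloidalWindowDoorPoloidalWindowRigidityZShockLocalEnergyCutoff
open Summit.NavierStokesRegularity.NavierStokesRegularity.Theorems.PoloidalWindowDoorPoloidalWindowRigidityZShockLocalEnergy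
open Summit.NavierStokesRegularity.NavierStokesRegularity.Theorems.PoloidalWindowDoorPoloidalWindowRigidityZShockPeriodicVirial
open Summit.NavierStokesRegularity.NavierStokesRegularity.Theorems.PoloidalWindowDoorPoloidalWindowRigidityZShockNoetherEnergyCoercive
open Summit.NavierStokesRegularity.NavierStokesRegularity.Theorems.PoloidalWindowDoorPoloidalWindowRigidityZShockNoetherConeEnergyClass
open Summit.NavierStokesRegularity.NavierStokesRegularity.Theorems.PoloidalWindowDoorPoloidalWindowRigidityZShockNoLocalizedBreatherTrivial

/-! ### The energy law in the `(s, y)` format -/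

/-- **The Noether energy law of the autonomous height-evolution, pointwise** (`∂ₛuᵢ = G(w)∂ᵢw`, `∂ₛw = −div u`; `Γ' = G`, `Ψ' = Γ` at the value):
`∂ₛ[Ψ(w⋆) − Ψ(w) + ½|u|²] + Σᵢ ∂ᵢ[−Γ(w) uᵢ] = 0`. [folklore] -/
theorem energyLaw_pointwise {u : Fin 2 → ℝ → EuclideanSpace ℝ (Fin 2) → ℝ} {w : ℝ → EuclideanSpace ℝ (Fin 2) → ℝ} {G Γ Ψ : ℝ → ℝ}
    {wstar s : ℝ} {y : EuclideanSpace ℝ (Fin 2)}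
    (hu : ∀ i, DifferentiableAt ℝ (u i s) y) (hw : DifferentiableAt ℝ (w s) y)
    (hΓ : HasDerivAt Γ (G (w s y)) (w s y)) (hΨ : HasDerivAt Ψ (Γ (w s y)) (w s y))
    (hus : ∀ i, HasDerivAt (fun s' => u i s' y) (G (w s y) * fderiv ℝ (w s) y (EuclideanSpace.single i 1)) s)
    (hws : HasDerivAt (fun s' => w s' y)
      (-(fderiv ℝ (u 0 s) y (EuclideanSpace.single 0 1) + fderiv ℝ (u 1 s) y (EuclideanSpace.single 1 1))) s) :
    deriv (fun s' => Ψ wstar - Ψ (w s' y) + (1 / 2) * (u 0 s' y ^ 2 + u 1 s' y ^ 2)) s +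
      ∑ i : Fin 2, fderiv ℝ (fun y' : EuclideanSpace ℝ (Fin 2) => -Γ (w s y') * u i s y') y (EuclideanSpace.single i 1) = 0 := by
  set e0 : EuclideanSpace ℝ (Fin 2) := EuclideanSpace.single 0 1 with he0
  set e1 : EuclideanSpace ℝ (Fin 2) := EuclideanSpace.single 1 1 with he1
  -- time derivative
  have h2 : ∀ i, HasDerivAt (fun s' => u i s' y ^ 2) (((2 : ℕ) : ℝ) * u i s y ^ (2 - 1) * (G (w s y) * fderiv ℝ (w s) y (EuclideanSpace.single i 1))) s :=
    fun i => (hus i).pow 2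
  have ht : HasDerivAt (fun s' => Ψ wstar - Ψ (w s' y) + (1 / 2) * (u 0 s' y ^ 2 + u 1 s' y ^ 2))
      (0 - Γ (w s y) * (-(fderiv ℝ (u 0 s) y e0 + fderiv ℝ (u 1 s) y e1)) +
        (1 / 2) * (((2 : ℕ) : ℝ) * u 0 s y ^ (2 - 1) * (G (w s y) * fderiv ℝ (w s) y e0) +
          ((2 : ℕ) : ℝ) * u 1 s y ^ (2 - 1) * (G (w s y) * fderiv ℝ (w s) y e1))) s :=
    ((hasDerivAt_const s (Ψ wstar)).sub (hΨ.comp s hws)).add (((h2 0).add (h2 1)).const_mul (1 / 2 : ℝ))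
  rw [ht.deriv]
  -- spatial derivatives
  have hU : ∀ i : Fin 2, HasFDerivAt (u i s) (fderiv ℝ (u i s) y) y := fun i => (hu i).hasFDerivAt
  have hΓW : HasFDerivAt (fun y' => Γ (w s y')) ((G (w s y)) • fderiv ℝ (w s) y) y := hΓ.comp_hasFDerivAt y hw.hasFDerivAt
  have hF : ∀ i : Fin 2, HasFDerivAt (fun y' : EuclideanSpace ℝ (Fin 2) => -Γ (w s y') * u i s y') _ y := fun i => hΓW.neg.mul (hU i)
  rw [Fin.sum_univ_two, (hF 0).fderiv, (hF 1).fderiv]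
  simp only [_root_.add_apply, _root_.smul_apply, _root_.neg_apply, Pi.neg_apply, smul_eq_mul, ← he0, ← he1]
  push_cast
  ring

/-! ### Uniform ball bounds give integrability -/

/-- **A continuous non-negative function with uniformly bounded ball integrals is integrable**, with the same bound. [folklore] -/
theorem integrable_of_ball_bounds {g : EuclideanSpace ℝ (Fin 2) → ℝ} (hg : Continuous g) (hg0 : ∀ y, 0 ≤ g y) {C : ℝ} (hC0 : 0 ≤ C)
    (hC : ∀ ρ : ℝ, ∫ y in closedBall (0 : EuclideanSpace ℝ (Fin 2)) ρ, g y ≤ C) :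
    Integrable g ∧ ∫ y, g y ≤ C := by
  -- monotone convergence for the truncations to balls of integer radius
  set F : ℕ → EuclideanSpace ℝ (Fin 2) → ℝ≥0∞ := fun n => (closedBall (0 : EuclideanSpace ℝ (Fin 2)) n).indicator fun y => ENNReal.ofReal (g y)
    with hF
  have hFm : ∀ n, Measurable (F n) := fun n => (hg.measurable.ennreal_ofReal).indicator measurableSet_closedBall
  have hFmono : Monotone F := by
    intro m n hmn y
    exact Set.indicator_le_indicator_of_subset (closedBall_subset_closedBall (by exact_mod_cast hmn)) (fun _ => bot_le) y
  have hFn : ∀ n, ∫⁻ y, F n y = ENNReal.ofReal (∫ y in closedBall (0 : EuclideanSpace ℝ (Fin 2)) n, g y) := by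
    intro n
    rw [hF, lintegral_indicator measurableSet_closedBall,
      ofReal_integral_eq_lintegral_ofReal (hg.continuousOn.integrableOn_compact (isCompact_closedBall _ _))
        (ae_of_all _ fun y => hg0 y)]
  have hsup : ∀ y, ENNReal.ofReal (g y) ≤ ⨆ n, F n y := by
    intro y
    obtain ⟨n, hn⟩ := exists_nat_ge ‖y‖
    refine le_iSup_of_le n ?_
    have hy : y ∈ closedBall (0 : EuclideanSpace ℝ (Fin 2)) n := by rw [mem_closedBall, dist_zero_right]; exact hn
    simp only [hF, Set.indicator_of_mem hy, le_refl]
  have hlin : ∫⁻ y, ENNReal.ofReal (g y) ≤ ENNReal.ofReal C := by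
    calc ∫⁻ y, ENNReal.ofReal (g y) ≤ ∫⁻ y, ⨆ n, F n y := lintegral_mono hsup
      _ = ⨆ n, ∫⁻ y, F n y := lintegral_iSup hFm hFmono
      _ ≤ ENNReal.ofReal C := iSup_le fun n => by rw [hFn n]; exact ENNReal.ofReal_le_ofReal (hC n)
  have hint : Integrable g := by
    refine ⟨hg.aestronglyMeasurable, ?_⟩
    show ∫⁻ y, ‖g y‖ₑ < ⊤
    have e : (fun y => ‖g y‖ₑ) = fun y => ENNReal.ofReal (g y) := funext fun y => by
      rw [Real.enorm_eq_ofReal (hg0 y)]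
    rw [e]
    exact lt_of_le_of_lt hlin ENNReal.ofReal_lt_top
  refine ⟨hint, ?_⟩
  rw [integral_eq_lintegral_of_nonneg_ae (ae_of_all _ fun y => hg0 y) hg.aestronglyMeasurable]
  exact ENNReal.toReal_le_of_le_ofReal hC0 hlin

/-! ### Propagation of the Noether energy -/

variable {u : Fin 2 → ℝ → EuclideanSpace ℝ (Fin 2) → ℝ} {w : ℝ → EuclideanSpace ℝ (Fin 2) → ℝ} {G Γ Ψ Θ : ℝ → ℝ}
  {wstar P γlo γhi t₀ : ℝ}

/-- **Domain of dependence for the centred Noether energy** (uniformly hyperbolic column, speed `γhi/√γlo`, no growth factor). [folklore] -/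
theorem noether_ball_le (hu : ∀ i, ContDiff ℝ ∞ (uncurry (u i))) (hw : ContDiff ℝ ∞ (uncurry w))
    (hΓs : ContDiff ℝ ∞ Γ) (hΨs : ContDiff ℝ ∞ Ψ) (hΓ : ∀ r, HasDerivAt Γ (G r) r) (hΨ : ∀ r, HasDerivAt Ψ (Γ r) r) (hΓ0 : Γ wstar = 0)
    (hγlo : 0 < γlo) (hGlo : ∀ r, G r ≤ -γlo) (hGhi : ∀ r, -γhi ≤ G r)
    (hus : ∀ i s y, HasDerivAt (fun s' => u i s' y) (G (w s y) * fderiv ℝ (w s) y (EuclideanSpace.single i 1)) s)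
    (hws : ∀ s y, HasDerivAt (fun s' => w s' y)
      (-(fderiv ℝ (u 0 s) y (EuclideanSpace.single 0 1) + fderiv ℝ (u 1 s) y (EuclideanSpace.single 1 1))) s)
    {t : ℝ} (ht : t₀ ≤ t) (ρ : ℝ) :
    ∫ y in closedBall (0 : EuclideanSpace ℝ (Fin 2)) ρ, (Ψ wstar - Ψ (w t y) + (1 / 2) * (u 0 t y ^ 2 + u 1 t y ^ 2)) ≤
      ∫ y in closedBall (0 : EuclideanSpace ℝ (Fin 2)) (√(1 + ρ ^ 2) + γhi / √γlo * (t - t₀) + 1),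
        (Ψ wstar - Ψ (w t₀ y) + (1 / 2) * (u 0 t₀ y ^ 2 + u 1 t₀ y ^ 2)) := by
  have hγhi : 0 ≤ γhi := by linarith [hGlo 0, hGhi 0]
  have hsq : Real.sqrt γlo ^ 2 = γlo := Real.sq_sqrt hγlo.le
  have hsqhi : Real.sqrt γhi ^ 2 = γhi := Real.sq_sqrt hγhi
  have hcmin : 0 < Real.sqrt γlo := Real.sqrt_pos.2 hγlo
  have hGc : ∀ r' : ℝ, ∀ r ∈ uIcc wstar r', G r ≤ -Real.sqrt γlo ^ 2 := fun r' r _ => by rw [hsq]; exact hGlo r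
  have hGb : ∀ r' : ℝ, ∀ r ∈ uIcc wstar r', |G r| ≤ Real.sqrt γhi ^ 2 := fun r' r _ => by
    rw [hsqhi, abs_le]; constructor <;> linarith [hGlo r, hGhi r, hγlo]
  -- the densities
  set e : ℝ → EuclideanSpace ℝ (Fin 2) → ℝ := fun s y => Ψ wstar - Ψ (w s y) + (1 / 2) * (u 0 s y ^ 2 + u 1 s y ^ 2) with he_def
  set f : Fin 2 → ℝ → EuclideanSpace ℝ (Fin 2) → ℝ := fun i s y => -Γ (w s y) * u i s y with hf_def
  set σ : ℝ → EuclideanSpace ℝ (Fin 2) → ℝ := fun _ _ => 0 with hσ_def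
  have hu2 : ContDiff ℝ ∞ (uncurry fun s (y : EuclideanSpace ℝ (Fin 2)) => u 0 s y ^ 2 + u 1 s y ^ 2) :=
    ((hu 0).pow 2).add ((hu 1).pow 2)
  have he : ContDiff ℝ ∞ (uncurry e) := (contDiff_const.sub (hΨs.comp hw)).add (contDiff_const.mul hu2)
  have hf : ∀ i, ContDiff ℝ ∞ (uncurry (f i)) := fun i => (hΓs.comp hw).neg.mul (hu i)
  have hσ : ContDiff ℝ ∞ (uncurry σ) := contDiff_const
  have hbal : ∀ s y, deriv (fun s' => e s' y) s + ∑ i, fderiv ℝ (f i s) y (EuclideanSpace.single i 1) = σ s y := fun s y =>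
    energyLaw_pointwise (fun i => ((contDiff_slice (hu i) s).differentiable (by simp)).differentiableAt)
      ((contDiff_slice hw s).differentiable (by simp)).differentiableAt (hΓ _) (hΨ _) (fun i => hus i s y) (hws s y)
  have hpos : ∀ s, t₀ ≤ s → ∀ y : EuclideanSpace ℝ (Fin 2), 0 ≤ e s y := fun s _ y =>
    (noetherEnergy_coercive hΓ hΨ hΓ0 (hGc (w s y)) (V := (1 / 2) * (u 0 s y ^ 2 + u 1 s y ^ 2)) (by positivity)).2
  have hflux : ∀ s, t₀ ≤ s → ∀ y : EuclideanSpace ℝ (Fin 2),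
      0 ≤ γhi / √γlo * √(1 + ‖y‖ ^ 2) * e s y + ∑ i, y i * f i s y := by
    intro s _ y
    set q : ℝ := Real.sqrt (u 0 s y ^ 2 + u 1 s y ^ 2) with hq
    have hq0 : 0 ≤ q := Real.sqrt_nonneg _
    have hq2 : (1 / 2) * q ^ 2 = (1 / 2) * (u 0 s y ^ 2 + u 1 s y ^ 2) := by rw [hq, Real.sq_sqrt (by positivity)]
    have hfl := noetherFlux_le_energy hΓ hΨ hΓ0 hcmin (hGc (w s y)) (hGb (w s y)) hq0
    rw [hsqhi, hq2] at hfl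
    -- `|y·u| ≤ ⟨y⟩ q`
    have hn : ‖y‖ ^ 2 = y 0 ^ 2 + y 1 ^ 2 := by rw [EuclideanSpace.norm_sq_eq, Fin.sum_univ_two]; simp [sq_abs]
    have hyu : |y 0 * u 0 s y + y 1 * u 1 s y| ≤ √(1 + ‖y‖ ^ 2) * q := by
      have hcs : (y 0 * u 0 s y + y 1 * u 1 s y) ^ 2 ≤ (1 + ‖y‖ ^ 2) * (u 0 s y ^ 2 + u 1 s y ^ 2) := by
        rw [hn]; nlinarith [sq_nonneg (y 0 * u 1 s y - y 1 * u 0 s y), sq_nonneg (u 0 s y), sq_nonneg (u 1 s y)]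
      rw [← Real.sqrt_sq (abs_nonneg _), sq_abs, hq, ← Real.sqrt_mul (by positivity)]
      exact Real.sqrt_le_sqrt hcs
    have hb := bracket_pos y
    have hsum : ∑ i : Fin 2, y i * f i s y = -Γ (w s y) * (y 0 * u 0 s y + y 1 * u 1 s y) := by
      rw [Fin.sum_univ_two]; simp only [hf_def]; ring
    rw [hsum]
    have h1 : |Γ (w s y) * (y 0 * u 0 s y + y 1 * u 1 s y)| ≤ √(1 + ‖y‖ ^ 2) * (γhi / √γlo * e s y) := by
      rw [abs_mul]
      calc |Γ (w s y)| * |y 0 * u 0 s y + y 1 * u 1 s y| ≤ |Γ (w s y)| * (√(1 + ‖y‖ ^ 2) * q) :=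
            mul_le_mul_of_nonneg_left hyu (abs_nonneg _)
        _ = √(1 + ‖y‖ ^ 2) * (|Γ (w s y)| * q) := by ring
        _ ≤ √(1 + ‖y‖ ^ 2) * (γhi / √γlo * e s y) := mul_le_mul_of_nonneg_left hfl hb.le
    have h2 := le_abs_self (Γ (w s y) * (y 0 * u 0 s y + y 1 * u 1 s y))
    have h3 : √(1 + ‖y‖ ^ 2) * (γhi / √γlo * e s y) = γhi / √γlo * √(1 + ‖y‖ ^ 2) * e s y := by ring
    rw [h3] at h1
    have h4 : -Γ (w s y) * (y 0 * u 0 s y + y 1 * u 1 s y) = -(Γ (w s y) * (y 0 * u 0 s y + y 1 * u 1 s y)) := by ring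
    rw [h4]
    linarith
  have hsrc : ∀ s, t₀ ≤ s → ∀ y : EuclideanSpace ℝ (Fin 2), σ s y ≤ 0 * e s y := fun s _ y => by simp [hσ_def]
  have h := setIntegral_closedBall_le_exp_mul he hf hσ hbal (c := γhi / √γlo) (t₀ := t₀) (K := 0) hpos hflux hsrc ht ρ
  simpa only [zero_mul, Real.exp_zero, one_mul] using h

/-! ### The theorem -/

/-- Iterated periodicity. [folklore] -/
theorem periodic_nat_mul {φ : ℝ → ℝ} {P : ℝ} (h : ∀ s, φ (s + P) = φ s) (n : ℕ) (s : ℝ) : φ (s + n * P) = φ s := by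
  induction n with
  | zero => simp
  | succ n ih =>
    have e : s + ((n + 1 : ℕ) : ℝ) * P = (s + n * P) + P := by push_cast; ring
    rw [e, h, ih]

/-- ★ **No breather with finite energy at one height** (hypotheses in the module docstring). [folklore] -/
theorem no_breather_of_finite_energy_at_one_height (hu : ∀ i, ContDiff ℝ ∞ (uncurry (u i))) (hw : ContDiff ℝ ∞ (uncurry w))
    (hΓs : ContDiff ℝ ∞ Γ) (hΨs : ContDiff ℝ ∞ Ψ) (hΓ : ∀ r, HasDerivAt Γ (G r) r) (hΨ : ∀ r, HasDerivAt Ψ (Γ r) r) (hΓ0 : Γ wstar = 0)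
    (hΘs : ContDiff ℝ ∞ Θ) (hΘ : ∀ r, HasDerivAt Θ ((r - wstar) * G r) r) (hΘ0 : Θ wstar = 0)
    (hγlo : 0 < γlo) (hGlo : ∀ r, G r ≤ -γlo) (hGhi : ∀ r, -γhi ≤ G r)
    (hus : ∀ i s y, HasDerivAt (fun s' => u i s' y) (G (w s y) * fderiv ℝ (w s) y (EuclideanSpace.single i 1)) s)
    (hws : ∀ s y, HasDerivAt (fun s' => w s' y)
      (-(fderiv ℝ (u 0 s) y (EuclideanSpace.single 0 1) + fderiv ℝ (u 1 s) y (EuclideanSpace.single 1 1))) s)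
    (hpol : ∀ s y, fderiv ℝ (u 0 s) y (EuclideanSpace.single 1 1) = fderiv ℝ (u 1 s) y (EuclideanSpace.single 0 1))
    (hP : 0 < P) (hPu : ∀ i s y, u i (s + P) y = u i s y) (hPw : ∀ s y, w (s + P) y = w s y)
    (hE0 : Integrable fun y => u 0 t₀ y ^ 2 + u 1 t₀ y ^ 2 + (w t₀ y - wstar) ^ 2) :
    (∀ s y, w s y = wstar) ∧ (∀ i s y, u i s y = 0) := by
  have hγhi : 0 ≤ γhi := by linarith [hGlo 0, hGhi 0]
  have hsq : Real.sqrt γlo ^ 2 = γlo := Real.sq_sqrt hγlo.le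
  have hsqhi : Real.sqrt γhi ^ 2 = γhi := Real.sq_sqrt hγhi
  -- the two densities and their comparison
  set E : ℝ → EuclideanSpace ℝ (Fin 2) → ℝ := fun s y => Ψ wstar - Ψ (w s y) + (1 / 2) * (u 0 s y ^ 2 + u 1 s y ^ 2) with hE_def
  set g : ℝ → EuclideanSpace ℝ (Fin 2) → ℝ := fun s y => u 0 s y ^ 2 + u 1 s y ^ 2 + (w s y - wstar) ^ 2 with hg_def
  have hgap_lo : ∀ s y, (1 / 2) * γlo * (w s y - wstar) ^ 2 ≤ Ψ wstar - Ψ (w s y) := fun s y => by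
    have h := concavityGap_of_slope_le (cmin := Real.sqrt γlo) hΓ hΨ hΓ0 (w := w s y) (fun r _ => by rw [hsq]; exact hGlo r)
    rwa [hsq] at h
  have hgap_hi : ∀ s y, Ψ wstar - Ψ (w s y) ≤ (1 / 2) * γhi * (w s y - wstar) ^ 2 := fun s y => by
    have h := concavityGap_le_of_slope_ge (cmax := Real.sqrt γhi) hΓ hΨ hΓ0 (w := w s y) (fun r _ => by rw [hsqhi]; exact hGhi r)
    rwa [hsqhi] at h
  have hEg : ∀ s y, g s y ≤ (2 + 2 / γlo) * E s y := by
    intro s y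
    have h1 := hgap_lo s y
    have hE : E s y = Ψ wstar - Ψ (w s y) + (1 / 2) * (u 0 s y ^ 2 + u 1 s y ^ 2) := rfl
    have hd : (w s y - wstar) ^ 2 ≤ 2 / γlo * (Ψ wstar - Ψ (w s y)) := by
      rw [div_mul_eq_mul_div, le_div_iff₀ hγlo]; nlinarith
    have hu2 : u 0 s y ^ 2 + u 1 s y ^ 2 ≤ 2 * E s y := by rw [hE]; nlinarith [sq_nonneg (w s y - wstar), hγlo]
    have hE0 : 0 ≤ Ψ wstar - Ψ (w s y) := by nlinarith [sq_nonneg (w s y - wstar)]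
    have : 2 / γlo * (Ψ wstar - Ψ (w s y)) ≤ 2 / γlo * E s y := by
      refine mul_le_mul_of_nonneg_left ?_ (by positivity); rw [hE]; nlinarith [sq_nonneg (u 0 s y), sq_nonneg (u 1 s y)]
    simp only [hg_def]; nlinarith
  have hgE : ∀ s y, E s y ≤ (1 / 2 + γhi / 2) * g s y := by
    intro s y
    have h1 := hgap_hi s y
    simp only [hE_def, hg_def]
    nlinarith [sq_nonneg (u 0 s y), sq_nonneg (u 1 s y), sq_nonneg (w s y - wstar)]
  have hEpos : ∀ s y, 0 ≤ E s y := fun s y => by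
    have := hgap_lo s y; simp only [hE_def]; nlinarith [sq_nonneg (w s y - wstar), sq_nonneg (u 0 s y), sq_nonneg (u 1 s y)]
  have hgpos : ∀ s y, 0 ≤ g s y := fun s y => by simp only [hg_def]; positivity
  -- continuity of the slices
  have hu2c : ContDiff ℝ ∞ (uncurry fun s (y : EuclideanSpace ℝ (Fin 2)) => u 0 s y ^ 2 + u 1 s y ^ 2) := ((hu 0).pow 2).add ((hu 1).pow 2)
  have hEc : ContDiff ℝ ∞ (uncurry E) := (contDiff_const.sub (hΨs.comp hw)).add (contDiff_const.mul hu2c)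
  have hgc : ContDiff ℝ ∞ (uncurry g) := hu2c.add ((hw.sub contDiff_const).pow 2)
  -- energy at the initial height
  have hEint0 : Integrable (E t₀) :=
    (hE0.const_mul (1 / 2 + γhi / 2)).mono' (contDiff_slice hEc t₀).continuous.aestronglyMeasurable
      (Eventually.of_forall fun y => by rw [Real.norm_eq_abs, abs_of_nonneg (hEpos t₀ y)]; exact hgE t₀ y)
  set I₀ : ℝ := ∫ y, E t₀ y with hI₀
  have hI₀0 : 0 ≤ I₀ := integral_nonneg fun y => hEpos t₀ y
  -- ball bounds for `g` at later heights
  have hball : ∀ t, t₀ ≤ t → ∀ ρ : ℝ, ∫ y in closedBall (0 : EuclideanSpace ℝ (Fin 2)) ρ, g t y ≤ (2 + 2 / γlo) * I₀ := by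
    intro t ht ρ
    have h1 := noether_ball_le hu hw hΓs hΨs hΓ hΨ hΓ0 hγlo hGlo hGhi hus hws ht ρ
    have h2 : ∫ y in closedBall (0 : EuclideanSpace ℝ (Fin 2)) (√(1 + ρ ^ 2) + γhi / √γlo * (t - t₀) + 1), E t₀ y ≤ I₀ :=
      setIntegral_le_integral hEint0 (Eventually.of_forall fun y => hEpos t₀ y)
    have hK : IsCompact (closedBall (0 : EuclideanSpace ℝ (Fin 2)) ρ) := isCompact_closedBall _ _
    calc ∫ y in closedBall (0 : EuclideanSpace ℝ (Fin 2)) ρ, g t y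
        ≤ ∫ y in closedBall (0 : EuclideanSpace ℝ (Fin 2)) ρ, (2 + 2 / γlo) * E t y :=
          setIntegral_mono_on ((contDiff_slice hgc t).continuous.continuousOn.integrableOn_compact hK)
            (((contDiff_slice hEc t).continuous.continuousOn.integrableOn_compact hK).const_mul _) measurableSet_closedBall
            fun y _ => hEg t y
      _ = (2 + 2 / γlo) * ∫ y in closedBall (0 : EuclideanSpace ℝ (Fin 2)) ρ, E t y := integral_const_mul _ _
      _ ≤ (2 + 2 / γlo) * I₀ := mul_le_mul_of_nonneg_left (h1.trans h2) (by positivity)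
  -- integrability and bound at every later height, then at every height by periodicity
  have hlater : ∀ t, t₀ ≤ t → Integrable (g t) ∧ ∫ y, g t y ≤ (2 + 2 / γlo) * I₀ := fun t ht =>
    integrable_of_ball_bounds (contDiff_slice hgc t).continuous (hgpos t) (by positivity) (hball t ht)
  have hall : ∀ s, Integrable (g s) ∧ ∫ y, g s y ≤ (2 + 2 / γlo) * I₀ := by
    intro s
    obtain ⟨n, hn⟩ := exists_nat_ge ((t₀ - s) / P)
    have hsn : t₀ ≤ s + n * P := by
      have : t₀ - s ≤ n * P := by rw [div_le_iff₀ hP] at hn; linarith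
      linarith
    have hper : g s = g (s + n * P) := by
      funext y
      simp only [hg_def]
      rw [periodic_nat_mul (φ := fun s' => u 0 s' y) (fun s' => hPu 0 s' y) n s,
        periodic_nat_mul (φ := fun s' => u 1 s' y) (fun s' => hPu 1 s' y) n s,
        periodic_nat_mul (φ := fun s' => w s' y) (fun s' => hPw s' y) n s]
    rw [hper]
    exact hlater _ hsn
  exact no_localized_breather_trivial hu hw hΘs hΘ hΘ0 hγlo hGlo hGhi hus hws hpol hP hPu hPw (fun s => (hall s).1) (fun s => (hall s).2)

end Summit.NavierStokesRegularity.NavierStokesRegularity.Theorems.PoloidalWindowDoorPoloidalWindowRigidityZShockBreatherOneHeight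

end
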